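import Summits.BirchSwinnertonDyer.BirchSwinnertonDyer.Theorems.EdixhovenFibreFiveSevenStarredOptimalManinUnitFiveSevenTransportedHodgeLineBdRPos
import Summits.BirchSwinnertonDyer.BirchSwinnertonDyer.Theorems.EdixhovenFibreFiveSevenStarredOptimalManinUnitFiveSevenTransportedHodgeLine
import Literature.NumberTheory.PAdicHodge.EisensteinHodgeLineNumerators
import HarnessLib

/-!
# `hne₀` for the transported Hodge pair from the cells' data alone: analytic Hodge line ⟹ numerator form ⟹ `Pω″(τ) = p^{N+c}·∫_τω ≠ 0`

Cell `pub/bsd-wall`, D-0145 line `route-BirchSwinnertonDyer-EdixhovenFibreFiveSeven`, seat `bsd-line-edix-p1` (gen 28); crux K★ `stmt-BirchSwinnertonDyer-22226`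
(`StarredOptimalManinUnitFiveSeven`), line `kato_lever`, memo `Cruxes/StarredOptimalManinUnitFiveSeven/Lines/kato-lever-K2-hne-direct-omega.md` (F3e).
THEOREMS ONLY; helper `--supports stmt-BirchSwinnertonDyer-22226`. **BSD is not proved by this file, and neither is K★.**

`exists_hodgePair_hne` packages the chain
`TransportedHodgeLine.exists_transportedHodgeLine` (Katz rank two ⟹ `‖p^d·[Xⁿ](log_W − A·log_{E₀} − B·log_{E₀}(Xᵖ))‖ ≤ 1`, `A = Σ aᵢϖⁱ`,
`B = Σ bᵢϖⁱ`, `aᵢ, bᵢ ∈ ℚ_p`) ⟹ `EisensteinHodgeLine.exists_hodgeLine_numerators` (numerator form with `p^c·aᵢ, p^c·bᵢ, hᵢ,ₘ ∈ ℤ_p`, `m ≥ 1`)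
⟹ `TransportedHodgeLineBdRPos.transported_hodgePair_ne_zero`: for edix-p4's honest transported period maps (`hLT hP₀ hQ₀`, `N ≥ e`) it
returns the Hodge-line scalars `a, b` TOGETHER WITH their analytic bound (so that the same `(A, B)` serves the `Fil¹`-statement of the cells)
and, for every `τ` with `∫_τ ω_{W_D} ≠ 0` (tree (N1′)), **`ι_F(p^c·A)·P⁰τ + ι_F(p^c·B)·Q⁰τ ≠ 0`** — the capstone's `hne₀` for
`Pω″ = ι(p^cA)·P⁰ + ι(p^cB)·Q⁰`, with NO appeal to Fontaine's injectivity `F ⊗ B_max⁺ → B_dR⁺`.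

v2 (append): `transported_hodgePair_mem_filOne` and ★★★ `exists_hodgePair_fil_and_hne` — the socket's `hfil₀` too follows from (ID)
(`Pω″τ = p^{N+c}·∫_τω ∈ Fil¹` for every `τ`), so ONE call delivers `hfil₀`, `hne₀`, `hAB` for `Pω″ = ι(p^cA)·P⁰ + ι(p^cB)·Q⁰`, and the bound `hM` is discharged
(`EisensteinPowerBasisNorms.exists_norm_rootC_pow_le_mul_norm_natCast`): hypotheses = `p ≠ 2`, `W ≡ E₀`, ellipticity, `hLT hP₀ hQ₀`.

References: [cite: Katz1981CrystallineDieudonne, Thm. 5.1.4] · [cite: Fontaine1982FormesDifferentielles, §5] · [cite: Colmez1992PeriodesAbeliennes, §2].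
-/

set_option autoImplicit false
-- single-conjunct summit: `Summit.BirchSwinnertonDyer.BirchSwinnertonDyer.…` repeats the name by design
set_option linter.dupNamespace false

noncomputable section

open scoped Classical
open ValuativeRel Field Ideal WittVector Finset Literature.NumberTheory.PAdicHodge Literature.NumberTheory.GaloisRepresentations
  Literature.NumberTheory.GaloisRepresentations.IsNonarchimedeanLocalField Literature.NumberTheory.GaloisRepresentations.LubinTate
  Literature.RingTheory.FormalGroups Literature.NumberTheory.PAdicHodge.GaloisContinuity

namespace Summit.BirchSwinnertonDyer.BirchSwinnertonDyer.Theorems.TransportedHodgePairHneOmega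

variable {F : Type} [Field F] [ValuativeRel F] [TopologicalSpace F] [IsNonarchimedeanLocalField F] [CharZero F]
  {p : ℕ} [hpp : Fact p.Prime] [Fact (¬ IsUnit (p : integerC F))] [IsAdicComplete (Ideal.span {(p : integerC F)}) (integerC F)]
  {hp : valuation F p < 1} (D : EisensteinRoot F p hp) {hθ : Function.Surjective (fontaineTheta (integerC F) p)} [CharZero (CompletedAlgClosure F)]
  (W : WeierstrassCurve (EisensteinRoot.CoeffDisc D)) (E₀ : WeierstrassCurve ℤ)
  (hWE : W.map (Ideal.Quotient.mk (Ideal.span {EisensteinRoot.CoeffDisc.of D (AdjoinRoot.root D.poly)})) =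
    (E₀.map (algebraMap ℤ (EisensteinRoot.CoeffDisc D))).map
      (Ideal.Quotient.mk (Ideal.span {EisensteinRoot.CoeffDisc.of D (AdjoinRoot.root D.poly)})))
  (ψ : EisensteinRoot.CoeffDisc D →+* LTCoeff F) (hψ : ∀ c, algebraMap (LTCoeff F) F (ψ c) = EisensteinRoot.CoeffDisc.toF D c)

omit [Fact (¬ IsUnit (p : integerC F))] [IsAdicComplete (Ideal.span {(p : integerC F)}) (integerC F)] [CharZero (CompletedAlgClosure F)] in
/-- The scalars of the numerator form in `F`: `Σᵢ (p^c·aᵢ)·ϖⁱ = p^c·Σᵢ aᵢϖⁱ` (`ℤ_p → ℚ_p → F` versus `K₀ → F`). [cite: SerreLocalFields1979, Ch. II §5] -/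
theorem sum_padicRingHom_eq_pow_mul (c : ℕ) (a : Fin D.e → PadicBase F p hp) (a' : Fin D.e → ℤ_[p])
    (ha' : ∀ i, ((a' i : ℤ_[p]) : ℚ_[p]) = (p : ℚ_[p]) ^ c * PadicBase.toPadic hp (a i)) :
    ∑ i : Fin D.e, LocalField.padicRingHom F p hp (a' i : ℚ_[p]) * D.root ^ (i : ℕ) =
      (p : F) ^ c * ∑ i : Fin D.e, algebraMap (PadicBase F p hp) F (a i) * D.root ^ (i : ℕ) := by
  rw [Finset.mul_sum]
  refine Finset.sum_congr rfl fun i _ => ?_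
  rw [ha' i, map_mul, map_pow, map_natCast, PadicBase.algebraMap_eq, PadicBase.emb_apply, mul_assoc]

omit [CharZero (CompletedAlgClosure F)] in
/-- `(A, B) ≠ 0` from `hne`: if `ι(A)·X + ι(B)·Y ≠ 0` then `A ≠ 0 ∨ B ≠ 0` (the capstone's `hAB`). [cite: Colmez1992PeriodesAbeliennes, §2] -/
theorem ne_zero_or_ne_zero_of_pair_ne_zero (hθ' : Function.Surjective (fontaineTheta (integerC F) p)) {A B : F} {X Y : BdRPlusTop F p}
    (h : BdRPlusTop.of F p (embBdRHom hp hθ' A) * X + BdRPlusTop.of F p (embBdRHom hp hθ' B) * Y ≠ 0) : A ≠ 0 ∨ B ≠ 0 := by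
  by_contra hAB
  simp only [not_or, not_ne_iff] at hAB
  exact h (by rw [hAB.1, hAB.2, map_zero, map_zero, zero_mul, zero_mul, add_zero])

include hWE hψ in
/-- ★★ **`hne₀` from the cells' data.** For `W/𝒪_D ≡ E₀ (mod ϖ)` (`p ≠ 2`, `E₀ ⊗ ℚ_p` and `E₀ ⊗ 𝔽_p` elliptic — the socket's instances; `‖ϖ‖ʲ ≤ M‖j‖`, a bound that holds for every
Eisenstein datum — `EisensteinPowerBasisNorms` §4, pending — and is kept as the hypothesis `hM` here)
and edix-p4's transported period maps `P⁰ = f∘LT`, `Q⁰ = f∘φ∘LT` (`hLT hP₀ hQ₀`, `N ≥ e`): there are Hodge-line scalars `a, b : Fin e → K₀` with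
the analytic bound `‖p^d·[Xⁿ](log_{W⊗ℂ_F} − A·log_{E₀} − B·log_{E₀}(Xᵖ))‖ ≤ 1` (`A = Σ aᵢϖⁱ`, `B = Σ bᵢϖⁱ`) and an exponent `c` such that
**`ι_F(p^c·A)·P⁰τ + ι_F(p^c·B)·Q⁰τ ≠ 0` for every `τ` with `∫_τ ω_{W_D} ≠ 0`.** [cite: Katz1981CrystallineDieudonne, Thm. 5.1.4]
[cite: Fontaine1982FormesDifferentielles, §5] [cite: Colmez1992PeriodesAbeliennes, §2] -/
theorem exists_hodgePair_hne (hp2 : p ≠ 2)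
    [(E₀.map (Int.castRingHom ℚ_[p])).IsElliptic] [(E₀.map (Int.castRingHom (ZMod p))).IsElliptic]
    {M : ℝ} (hM0 : 0 ≤ M) (hM : ∀ j : ℕ, 1 ≤ j → ‖((D.rootC : integerC F) : CompletedAlgClosure F)‖ ^ j ≤ M * ‖(j : CompletedAlgClosure F)‖)
    {N : ℕ} (hN : D.e ≤ N) {LT : AinfTop.TatePtO F (W.map ψ) p →+ BmaxPlus F p} {P₀ Q₀ : AinfTop.TatePtO F (W.map ψ) p →+ BdRPlusTop F p}
    (hLT : ∀ (τ : AinfTop.TatePtO F (W.map ψ) p) (w : ℕ → (maxNilIdealC F).toIdeal) (hw : ∀ n, AinfTop.mulPC F p E₀ (w (n + 1)) = w n)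
        (_ : ∀ n, ‖(((w n : (maxNilIdealC F).toIdeal) : CBall F) : CompletedAlgClosure F) -
      (((AinfTop.seqO (W.map ψ) τ n : (maxNilIdealC F).toIdeal) : CBall F) : CompletedAlgClosure F)‖ ≤ ‖((D.rootC : integerC F) : CompletedAlgClosure F)‖)
        (z : bmaxZero F p), algebraMap (Ainf (p := p) F) (bmaxZero F p)
        ((AinfTop.of F p).symm (((AinfTop.divisionLiftPt E₀ hθ w hw).val : (AinfTop.nilTheta F p hθ).toIdeal) : AinfTop F p)) ^ N =
      (p : bmaxZero F p) * z →
        LT τ = PadicLogSeries.logSum ((algebraMap (Ainf (p := p) F) (bmaxZero F p)).comp zpToAinf) (GaloisContinuity.formalLogNum E₀ p) N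
          (algebraMap (Ainf (p := p) F) (bmaxZero F p)
            ((AinfTop.of F p).symm (((AinfTop.divisionLiftPt E₀ hθ w hw).val : (AinfTop.nilTheta F p hθ).toIdeal) : AinfTop F p))) z)
    (hP₀ : ∀ τ, P₀ τ = BdRPlusTop.of F p (bmaxPlusToBdR F p (LT τ)))
    (hQ₀ : ∀ τ, Q₀ τ = BdRPlusTop.of F p (bmaxPlusToBdR F p (frobBmaxPlus F p (LT τ)))) :
    ∃ (a b : Fin D.e → PadicBase F p hp) (d c : ℕ),
      (∀ n : ℕ, ‖(p : CompletedAlgClosure F) ^ d * PowerSeries.coeff n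
        ((W.map ((CBall F).subtype.comp (EisensteinRoot.CoeffDisc.toCBall D))).formalLog -
          PowerSeries.C (∑ i : Fin D.e, algebraMap F (CompletedAlgClosure F) (algebraMap (PadicBase F p hp) F (a i)) *
              ((D.rootC : integerC F) : CompletedAlgClosure F) ^ (i : ℕ)) *
            (E₀.map (Int.castRingHom (CompletedAlgClosure F))).formalLog -
          PowerSeries.C (∑ i : Fin D.e, algebraMap F (CompletedAlgClosure F) (algebraMap (PadicBase F p hp) F (b i)) *
              ((D.rootC : integerC F) : CompletedAlgClosure F) ^ (i : ℕ)) *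
            PowerSeries.expand p hpp.out.ne_zero (E₀.map (Int.castRingHom (CompletedAlgClosure F))).formalLog)‖ ≤ 1) ∧
      ∀ τ : AinfTop.TatePtO F (W.map ψ) p,
        AinfRamTop.omegaPeriod W hθ (AinfTop.seqO (W.map ψ) τ) (AinfTop.seqO_zero (W.map ψ) τ) (AinfRamTop.mulPC_seqO W ψ hψ τ) ≠ 0 →
        BdRPlusTop.of F p (embBdRHom hp hθ ((p : F) ^ c * ∑ i : Fin D.e, algebraMap (PadicBase F p hp) F (a i) * D.root ^ (i : ℕ))) * P₀ τ +
          BdRPlusTop.of F p (embBdRHom hp hθ ((p : F) ^ c * ∑ i : Fin D.e, algebraMap (PadicBase F p hp) F (b i) * D.root ^ (i : ℕ))) * Q₀ τ ≠ 0 := by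
  have e1 : (E₀.map (Int.castRingHom ℤ_[p])).map PadicInt.Coe.ringHom = E₀.map (Int.castRingHom ℚ_[p]) := by
    rw [WeierstrassCurve.map_map]; exact congrArg E₀.map (Subsingleton.elim _ _)
  have e2 : (E₀.map (Int.castRingHom ℤ_[p])).map PadicInt.toZMod = E₀.map (Int.castRingHom (ZMod p)) := by
    rw [WeierstrassCurve.map_map]; exact congrArg E₀.map (Subsingleton.elim _ _)
  haveI : ((E₀.map (Int.castRingHom ℤ_[p])).map PadicInt.Coe.ringHom).IsElliptic := by rw [e1]; infer_instance
  haveI : ((E₀.map (Int.castRingHom ℤ_[p])).map PadicInt.toZMod).IsElliptic := by rw [e2]; infer_instance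
  obtain ⟨a, b, d, hAB⟩ := TransportedHodgeLine.exists_transportedHodgeLine D hp2 W E₀ hWE hM0 hM
  obtain ⟨c, a', b', h, ha', hb', hHL⟩ := EisensteinHodgeLine.exists_hodgeLine_numerators D W E₀ a b d hAB
  refine ⟨a, b, d, c, hAB, fun τ hΩ => ?_⟩
  rw [← sum_padicRingHom_eq_pow_mul D c a a' ha', ← sum_padicRingHom_eq_pow_mul D c b b' hb']
  exact TransportedHodgeLineBdRPos.transported_hodgePair_ne_zero D W E₀ hWE ψ hψ hN hLT hP₀ hQ₀ c a' b' h hHL τ hΩ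

omit [CharZero (CompletedAlgClosure F)] in
include hWE hψ in
/-- ★ **The transported Hodge pair is `Fil¹`-valued on the whole Tate module** (numerator form): `ι_F(A′)·P⁰τ + ι_F(B′)·Q⁰τ = p^{N+c}·∫_τω ∈ Fil¹B_dR⁺`
for EVERY `τ ∈ T_pŴ_D` (`∫_τω ∈ Fil¹`, tree `AinfRamTop.omegaPeriod_mem_filOne`) — the socket's `hfil₀`, from the identity (ID) alone.
[cite: Fontaine1982FormesDifferentielles, §5] [cite: Colmez1992PeriodesAbeliennes, §2] -/
theorem transported_hodgePair_mem_filOne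
    [(E₀.map (Int.castRingHom ℚ_[p])).IsElliptic] [(E₀.map (Int.castRingHom (ZMod p))).IsElliptic]
    {N : ℕ} (hN : D.e ≤ N) {LT : AinfTop.TatePtO F (W.map ψ) p →+ BmaxPlus F p} {P₀ Q₀ : AinfTop.TatePtO F (W.map ψ) p →+ BdRPlusTop F p}
    (hLT : ∀ (τ : AinfTop.TatePtO F (W.map ψ) p) (w : ℕ → (maxNilIdealC F).toIdeal) (hw : ∀ n, AinfTop.mulPC F p E₀ (w (n + 1)) = w n)
        (_ : ∀ n, ‖(((w n : (maxNilIdealC F).toIdeal) : CBall F) : CompletedAlgClosure F) -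
      (((AinfTop.seqO (W.map ψ) τ n : (maxNilIdealC F).toIdeal) : CBall F) : CompletedAlgClosure F)‖ ≤ ‖((D.rootC : integerC F) : CompletedAlgClosure F)‖)
        (z : bmaxZero F p), algebraMap (Ainf (p := p) F) (bmaxZero F p)
        ((AinfTop.of F p).symm (((AinfTop.divisionLiftPt E₀ hθ w hw).val : (AinfTop.nilTheta F p hθ).toIdeal) : AinfTop F p)) ^ N =
      (p : bmaxZero F p) * z →
        LT τ = PadicLogSeries.logSum ((algebraMap (Ainf (p := p) F) (bmaxZero F p)).comp zpToAinf) (GaloisContinuity.formalLogNum E₀ p) N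
          (algebraMap (Ainf (p := p) F) (bmaxZero F p)
            ((AinfTop.of F p).symm (((AinfTop.divisionLiftPt E₀ hθ w hw).val : (AinfTop.nilTheta F p hθ).toIdeal) : AinfTop F p))) z)
    (hP₀ : ∀ τ, P₀ τ = BdRPlusTop.of F p (bmaxPlusToBdR F p (LT τ)))
    (hQ₀ : ∀ τ, Q₀ τ = BdRPlusTop.of F p (bmaxPlusToBdR F p (frobBmaxPlus F p (LT τ))))
    (c : ℕ) (a' b' : Fin D.e → ℤ_[p]) (h : Fin D.e → ℕ → ℤ_[p])
    (hHL : ∀ m : ℕ, 0 < m → (p : D.Coeff) ^ c * (EisensteinRoot.CoeffDisc.of D).symm (PowerSeries.coeff (m - 1) W.formalInvDiff) =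
      ∑ i : Fin D.e, AdjoinRoot.root D.poly ^ (i : ℕ) *
        (AdjoinRoot.of D.poly (a' i) * AdjoinRoot.of D.poly (GaloisContinuity.formalLogNum E₀ p m) +
          AdjoinRoot.of D.poly (b' i) * (if p ∣ m then (p : D.Coeff) * AdjoinRoot.of D.poly (GaloisContinuity.formalLogNum E₀ p (m / p)) else 0) +
          (m : D.Coeff) * AdjoinRoot.of D.poly (h i m)))
    (τ : AinfTop.TatePtO F (W.map ψ) p) :
    BdRPlusTop.of F p (embBdRHom hp hθ (∑ i : Fin D.e, LocalField.padicRingHom F p hp (a' i : ℚ_[p]) * D.root ^ (i : ℕ))) * P₀ τ +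
        BdRPlusTop.of F p (embBdRHom hp hθ (∑ i : Fin D.e, LocalField.padicRingHom F p hp (b' i : ℚ_[p]) * D.root ^ (i : ℕ))) * Q₀ τ ∈
      (BdRPlusTop.filOne F p).toIdeal := by
  rw [← TransportedHodgeLineBdRPos.sum_root_pow_mul_eq_pair D hθ a' b' (P₀ τ) (Q₀ τ),
    TransportedHodgeLineBdRPos.transported_hodgeCombination_eq_pow_mul_omegaPeriod D W E₀ hWE ψ hψ hN hLT hP₀ hQ₀ c a' b' h hHL τ]
  exact Ideal.mul_mem_left _ _ (AinfRamTop.omegaPeriod_mem_filOne W _ _)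

include hWE hψ in
/-- ★★★ **The socket's `hfil₀`, `hne₀` (and `hAB`) from the cells' data in ONE call, with NO bound hypothesis.** As `exists_hodgePair_hne`
(the bound `‖ϖ‖ʲ ≤ M‖j‖` is now discharged by `EisensteinPowerBasisNorms.exists_norm_rootC_pow_le_mul_norm_natCast`), and in addition the pair
`Pω″ = ι_F(p^c·A)·P⁰ + ι_F(p^c·B)·Q⁰` is `Fil¹`-valued at EVERY `τ` (no torsion-tower argument, no Fontaine injectivity).
[cite: Katz1981CrystallineDieudonne, Thm. 5.1.4] [cite: Fontaine1982FormesDifferentielles, §5] [cite: Colmez1992PeriodesAbeliennes, §2] -/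
theorem exists_hodgePair_fil_and_hne (hp2 : p ≠ 2)
    [(E₀.map (Int.castRingHom ℚ_[p])).IsElliptic] [(E₀.map (Int.castRingHom (ZMod p))).IsElliptic]
    {N : ℕ} (hN : D.e ≤ N) {LT : AinfTop.TatePtO F (W.map ψ) p →+ BmaxPlus F p} {P₀ Q₀ : AinfTop.TatePtO F (W.map ψ) p →+ BdRPlusTop F p}
    (hLT : ∀ (τ : AinfTop.TatePtO F (W.map ψ) p) (w : ℕ → (maxNilIdealC F).toIdeal) (hw : ∀ n, AinfTop.mulPC F p E₀ (w (n + 1)) = w n)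
        (_ : ∀ n, ‖(((w n : (maxNilIdealC F).toIdeal) : CBall F) : CompletedAlgClosure F) -
      (((AinfTop.seqO (W.map ψ) τ n : (maxNilIdealC F).toIdeal) : CBall F) : CompletedAlgClosure F)‖ ≤ ‖((D.rootC : integerC F) : CompletedAlgClosure F)‖)
        (z : bmaxZero F p), algebraMap (Ainf (p := p) F) (bmaxZero F p)
        ((AinfTop.of F p).symm (((AinfTop.divisionLiftPt E₀ hθ w hw).val : (AinfTop.nilTheta F p hθ).toIdeal) : AinfTop F p)) ^ N =
      (p : bmaxZero F p) * z →
        LT τ = PadicLogSeries.logSum ((algebraMap (Ainf (p := p) F) (bmaxZero F p)).comp zpToAinf) (GaloisContinuity.formalLogNum E₀ p) N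
          (algebraMap (Ainf (p := p) F) (bmaxZero F p)
            ((AinfTop.of F p).symm (((AinfTop.divisionLiftPt E₀ hθ w hw).val : (AinfTop.nilTheta F p hθ).toIdeal) : AinfTop F p))) z)
    (hP₀ : ∀ τ, P₀ τ = BdRPlusTop.of F p (bmaxPlusToBdR F p (LT τ)))
    (hQ₀ : ∀ τ, Q₀ τ = BdRPlusTop.of F p (bmaxPlusToBdR F p (frobBmaxPlus F p (LT τ)))) :
    ∃ (a b : Fin D.e → PadicBase F p hp) (d c : ℕ),
      (∀ n : ℕ, ‖(p : CompletedAlgClosure F) ^ d * PowerSeries.coeff n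
        ((W.map ((CBall F).subtype.comp (EisensteinRoot.CoeffDisc.toCBall D))).formalLog -
          PowerSeries.C (∑ i : Fin D.e, algebraMap F (CompletedAlgClosure F) (algebraMap (PadicBase F p hp) F (a i)) *
              ((D.rootC : integerC F) : CompletedAlgClosure F) ^ (i : ℕ)) *
            (E₀.map (Int.castRingHom (CompletedAlgClosure F))).formalLog -
          PowerSeries.C (∑ i : Fin D.e, algebraMap F (CompletedAlgClosure F) (algebraMap (PadicBase F p hp) F (b i)) *
              ((D.rootC : integerC F) : CompletedAlgClosure F) ^ (i : ℕ)) *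
            PowerSeries.expand p hpp.out.ne_zero (E₀.map (Int.castRingHom (CompletedAlgClosure F))).formalLog)‖ ≤ 1) ∧
      (∀ τ : AinfTop.TatePtO F (W.map ψ) p,
        BdRPlusTop.of F p (embBdRHom hp hθ ((p : F) ^ c * ∑ i : Fin D.e, algebraMap (PadicBase F p hp) F (a i) * D.root ^ (i : ℕ))) * P₀ τ +
          BdRPlusTop.of F p (embBdRHom hp hθ ((p : F) ^ c * ∑ i : Fin D.e, algebraMap (PadicBase F p hp) F (b i) * D.root ^ (i : ℕ))) * Q₀ τ ∈
          (BdRPlusTop.filOne F p).toIdeal) ∧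
      ∀ τ : AinfTop.TatePtO F (W.map ψ) p,
        AinfRamTop.omegaPeriod W hθ (AinfTop.seqO (W.map ψ) τ) (AinfTop.seqO_zero (W.map ψ) τ) (AinfRamTop.mulPC_seqO W ψ hψ τ) ≠ 0 →
        BdRPlusTop.of F p (embBdRHom hp hθ ((p : F) ^ c * ∑ i : Fin D.e, algebraMap (PadicBase F p hp) F (a i) * D.root ^ (i : ℕ))) * P₀ τ +
          BdRPlusTop.of F p (embBdRHom hp hθ ((p : F) ^ c * ∑ i : Fin D.e, algebraMap (PadicBase F p hp) F (b i) * D.root ^ (i : ℕ))) * Q₀ τ ≠ 0 := by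
  have e1 : (E₀.map (Int.castRingHom ℤ_[p])).map PadicInt.Coe.ringHom = E₀.map (Int.castRingHom ℚ_[p]) := by
    rw [WeierstrassCurve.map_map]; exact congrArg E₀.map (Subsingleton.elim _ _)
  have e2 : (E₀.map (Int.castRingHom ℤ_[p])).map PadicInt.toZMod = E₀.map (Int.castRingHom (ZMod p)) := by
    rw [WeierstrassCurve.map_map]; exact congrArg E₀.map (Subsingleton.elim _ _)
  haveI : ((E₀.map (Int.castRingHom ℤ_[p])).map PadicInt.Coe.ringHom).IsElliptic := by rw [e1]; infer_instance
  haveI : ((E₀.map (Int.castRingHom ℤ_[p])).map PadicInt.toZMod).IsElliptic := by rw [e2]; infer_instance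
  obtain ⟨M, hM0, hM⟩ := exists_norm_rootC_pow_le_mul_norm_natCast D
  obtain ⟨a, b, d, hAB⟩ := TransportedHodgeLine.exists_transportedHodgeLine D hp2 W E₀ hWE hM0 hM
  obtain ⟨c, a', b', h, ha', hb', hHL⟩ := EisensteinHodgeLine.exists_hodgeLine_numerators D W E₀ a b d hAB
  refine ⟨a, b, d, c, hAB, fun τ => ?_, fun τ hΩ => ?_⟩
  · rw [← sum_padicRingHom_eq_pow_mul D c a a' ha', ← sum_padicRingHom_eq_pow_mul D c b b' hb']
    exact transported_hodgePair_mem_filOne D W E₀ hWE ψ hψ hN hLT hP₀ hQ₀ c a' b' h hHL τ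
  · rw [← sum_padicRingHom_eq_pow_mul D c a a' ha', ← sum_padicRingHom_eq_pow_mul D c b b' hb']
    exact TransportedHodgeLineBdRPos.transported_hodgePair_ne_zero D W E₀ hWE ψ hψ hN hLT hP₀ hQ₀ c a' b' h hHL τ hΩ

end Summit.BirchSwinnertonDyer.BirchSwinnertonDyer.Theorems.TransportedHodgePairHneOmega
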